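import Summits.AtomisticToContinuum.HydrodynamicLimit.Theorems.LambertianContactSwapSwapGapLiouvilleInvarianceLambda
import Summits.AtomisticToContinuum.HydrodynamicLimit.Theorems.LambertianContactSwapLambertianEulerGibbsInvariance
import Summits.AtomisticToContinuum.HydrodynamicLimit.Theorems.LambertianContactSwapSwapGapEntropyTools
import HarnessLib

/-!
# `SwapGap` (stmt-AtomisticToContinuum-11850), line `Sketch`: ECHO MEAN RETURN is exact at equilibrium

Helper file (`--supports stmt-AtomisticToContinuum-11850`) of line `Sketch` (entropy relative to the
Lambertian law, reversed direction, skeleton v12 §12) for the crux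
`Summit.AtomisticToContinuum.HydrodynamicLimit.Theses.LambertianContactSwap.SwapGap`, registered stub
`stub_echoMeanReturn_equilibrium` (T20, rung "echo mean return is exact at equilibrium").

Notation: `P_N = localGibbsLaw σ a u θ N Φ` with CONSTANT profiles `a, u, θ` (the homogeneous Gibbs
law), `G_N = localGibbsLaw σ 1 0 1 N Φ`, `L_N = llr P_N G_N`, `Φ_t` a hard-sphere flow, `Λ_t(z, ξs) =
lambertFlow (Torus.geometry (Fin 3)) (hsDiameter σ N) ξs z t` the Lambertian flow with i.i.d. redraw
noise `γ^ℕ = lambertNoise (Fin 3)`.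

WHAT.  The research stub S1ʳ′ `stub_echoMeanReturn` of the reversed entropy line asks that the ECHO
DEFICIT `∫ L_N dP_N − ∫ L_N(Φ_{-t}(Λ_t p)) d(P_N ⊗ γ^ℕ)` be `o(N)` pre-shock.  On the equilibrium rung
(constant profiles) it is EXACTLY `0`, for every `0 < σ < 1/2`, every `N`, every flow `Φ` and every
`t ≥ 0` — so no equilibrium witness can refute S1ʳ′.

MECHANISM.  At equilibrium the law is invariant under BOTH dynamics: `(Λ_t)_* (P_N ⊗ γ^ℕ) = P_N`
(`LambertianContactSwapLambertianEulerGibbsInvariance.gibbsInvariance_of_liouvilleInvariance` fed with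
the `Λ`-invariance of `liouville ⊗ γ^ℕ`,
`LambertianContactSwapSwapGapLiouvilleInvarianceLambda.stub_liouvilleInvarianceLambda`) and
`(Φ_{-t})_* P_N = P_N` (`map_flow_localGibbsLaw_const`).  Hence the law of the echo
`Φ_{-t} ∘ Λ_t` under `P_N ⊗ γ^ℕ` is `P_N` itself, and by two changes of variables (`integral_map`)
`∫ L_N(Φ_{-t}(Λ_t p)) d(P_N ⊗ γ^ℕ) = ∫ L_N d((Φ_{-t})_* (Λ_t)_* (P_N ⊗ γ^ℕ)) = ∫ L_N dP_N`.
No positivity of `a, θ` is used.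

prover-line-stmt-AtomisticToContinuum-11850-c6-0 (lead c6, cycle 7, wave 8).
-/

noncomputable section

open MeasureTheory Filter Set Topology InformationTheory
open scoped ENNReal

namespace Summit.AtomisticToContinuum.HydrodynamicLimit.Theorems

open Literature.Analysis.FluidPDE Literature.MathematicalPhysics.KineticTheory

/-- **Mean of an observable along a law-preserving two-step echo.** If `g` pushes `μ` to `ν` and
`φ` preserves `ν`, then `∫ f(φ(g x)) dμ = ∫ f dν` for every measurable real `f` (two changes of
variables, `integral_map`). [folklore] -/
theorem integral_comp_comp_eq_of_map_eq {α β : Type*} [MeasurableSpace α] [MeasurableSpace β]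
    {μ : Measure α} {ν : Measure β} {g : α → β} {φ : β → β} {f : β → ℝ}
    (hg : Measurable g) (hφ : Measurable φ) (hf : Measurable f)
    (hμ : μ.map g = ν) (hν : ν.map φ = ν) :
    ∫ x, f (φ (g x)) ∂μ = ∫ y, f y ∂ν :=
  calc ∫ x, f (φ (g x)) ∂μ = ∫ y, f (φ y) ∂(μ.map g) :=
        (integral_map hg.aemeasurable (hf.comp hφ).aestronglyMeasurable).symm
    _ = ∫ y, f y ∂(ν.map φ) := by
        rw [hμ]
        exact (integral_map hφ.aemeasurable hf.aestronglyMeasurable).symm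
    _ = ∫ y, f y ∂ν := by rw [hν]

/-- **T20 · ECHO MEAN RETURN HOLDS EXACTLY AT EQUILIBRIUM** (registered stub
`stub_echoMeanReturn_equilibrium` of line `Sketch`, skeleton v12 §12): for CONSTANT profiles
`a₀ ≡ a`, `θ₀ ≡ θ`, `u₀ ≡ u`, `0 < σ < 1/2`, every `N`, every hard-sphere flow `Φ` and every `t ≥ 0`,
the echo deficit `∫ L_N dP_N − ∫ L_N(Φ_{-t}(Λ_t p)) d(P_N ⊗ γ^ℕ)` of the log-likelihood
`L_N = llr P_N G_N` VANISHES: the homogeneous Gibbs law `P_N` is invariant under `Λ_t` in law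
(`gibbsInvariance_of_liouvilleInvariance` + `stub_liouvilleInvarianceLambda`) and under `Φ_{-t}`
(`map_flow_localGibbsLaw_const`), so the echo law `(Φ_{-t})_* (Λ_t)_* (P_N ⊗ γ^ℕ)` is `P_N` and the
two means coincide (`integral_comp_comp_eq_of_map_eq`).  The hypotheses `0 < a`, `0 < θ` are not
needed. [folklore] -/
theorem stub_echoMeanReturn_equilibrium :
    ∀ (a θ : ℝ) (u : V3), 0 < a → 0 < θ → ∀ σ : ℝ, 0 < σ → σ < 2⁻¹ →
      ∀ (N : ℕ) (Φ : HardSphereFlow (Torus.geometry (Fin 3)) (hsDiameter σ N) (N + 1)) (t : ℝ), 0 ≤ t →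
        (∫ z, llr (localGibbsLaw σ (fun _ => a) (fun _ => u) (fun _ => θ) N Φ)
            (localGibbsLaw σ (fun _ => 1) (fun _ => 0) (fun _ => 1) N Φ) z
            ∂(localGibbsLaw σ (fun _ => a) (fun _ => u) (fun _ => θ) N Φ)) -
          ∫ p, llr (localGibbsLaw σ (fun _ => a) (fun _ => u) (fun _ => θ) N Φ)
            (localGibbsLaw σ (fun _ => 1) (fun _ => 0) (fun _ => 1) N Φ)
            (Φ.flow (-t) (lambertFlow (Torus.geometry (Fin 3)) (hsDiameter σ N) p.2 p.1 t))
            ∂((localGibbsLaw σ (fun _ => a) (fun _ => u) (fun _ => θ) N Φ).prod (lambertNoise (Fin 3))) = 0 := by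
  intro a θ u _ _ σ hσ hσ' N Φ t ht
  rw [sub_eq_zero]
  exact (integral_comp_comp_eq_of_map_eq (measurable_lambertFlow_hsDiameter hσ.le hσ' N t)
    (Φ.measurable_flow (-t)) (measurable_llr _ _)
    (LambertianContactSwapLambertianEulerGibbsInvariance.gibbsInvariance_of_liouvilleInvariance
      LambertianContactSwapSwapGapLiouvilleInvarianceLambda.stub_liouvilleInvarianceLambda
      hσ hσ' N a θ u Φ ht)
    (map_flow_localGibbsLaw_const σ a θ u N Φ (-t))).symm

end Summit.AtomisticToContinuum.HydrodynamicLimit.Theorems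

end
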